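import Summits.QuantumFields.YangMills.Theorems.BalabanUVNodesK0GenericCubeOfStepTokensR
import Literature.MathematicalPhysics.QuantumFieldTheory.Balaban1983to89.Node00.TorusCoverGaugeTokensRPrint

/-!
# K0⁷ — Cʷ‴ PART 2: THE PRINT-CUBE COMPOSITION — K0⁷'s body on every family from stub 1 ([15] Prop. 8's top step), STUB 2′ ([6] Prop. 6 on PRINT's cube class at
# big-block size `ρ₀`, `Node00.zdCubP`) and 3ᴬ′ (the sign-free β-box of A1's witness, generic in the cube letter)

Cell `pub-ymgap`, seat `pub-ymgap-dag-n21-c` generation 16 (K0⁷ road lineage; plan g79 WORDS-1 (B) l.24699 ∕ WORD-B1-DECLARER l.24860: stub-2 repair of record (R-b), item (b3);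
plan AGREED the threading l.25405).  `--kind proof --supports stmt-QuantumFields-20541 --as helper`.  NEW leaf over PART 1 (p589753), dag-n07-e's (b2) 36c `Node00.TorusCoverGaugeTokensRPrint`
and k0-s2-w2's (b1) `Node00.CarriersB8CubePrint`; nothing modified; no new named fact; 0 `def`.

WHY.  The located fact behind (R-b) (k0-s2-w2 evidence #22): V18's stub 2 reads [6] Prop. 6 on ALL `CubeB8` cubes down to thin collars `ρ = L`, while print's proof (p. 98) covers only cubes
at big-block size `ρ₀ = R₁M₁` (collar∕side∕corners on the `ρ₀`-grid) — stub 2′ := `∃ ρ₀ B₁ c₁, 1 ≤ ρ₀ ∧ 0 ≤ B₁ ∧ 0 < c₁ ∧ B8.Prop6Printed 4 L B₁ c₁ (zdCubP (MatA 2) L ρ₀ ·)` is the print-faithful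
text ((b1)), WEAKER than stub 2 (§3).  (b2) re-derived the floor-carrying (9)-token from stub 2′ at EVERY cube letter `M` with the floor letter `c(ρ₀) = (11·4 + 4·(ρ₀·L))·L` and constants
`b9OfP`, `a0OfP` (`gauge9RP_of_prop8TopStep_of_prop6P_of_one_le`).  PART 1 made the K0 road generic in the cube letter `(j, c)` under `c ≤ L^j`.  This file threads `ρ₀` through the ONE place
it enters — the floor letter — by choosing the witness index `j := ρ₀ + 3` (§1: `c(ρ₀) ≤ L^(ρ₀+3)` for `L ≥ 13`), and composes: stub 1 ∧ stub 2′ ∧ 3ᴬ′ ⟹ K0⁷'s body on every family (§2).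
This is the (b3) input of the plan's V19 re-cut (V18 STANDS until the plan registers it).

CONTENTS.  §1 `floorP_mul_le_pow`, `gauge9Supplier_of_prop6MemberP` (stub 2′ at `F` ⟹ PART 1's supplier slot at `F`).  §2 ★★★ `record13SepCoPHBody_of_stubs1_2P_3A'`.  §3 `prop6MemberP_of_prop6Member`
(V18 stub 2 ⟹ stub 2′: the direction of the repair, sanity).

HONEST FRAMING: count-neutral kernel bookkeeping BY NAME; CONDITIONAL composition whose antecedents are OPEN (A6: not inhabited here — stub 1 = N07's [15] Prop. 8 ∕ Sect. F at objects,
stub 2′ = N05's [6] Prop. 6 on print's cubes (γ ∕ PRINTED-ALL roads in flight), 3ᴬ′ = NODE O, print-STATED [I] §1 p.264 with unpublished proof [II] p.355); nothing of Bałaban asserted; K0⁷ OPEN;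
counts unmoved (typed 28∕28 · discharged 5∕27); one finite 𝕋⁴ programme at fixed ε — NOT continuum ∕ ℝ⁴ ∕ OS ∕ mass gap ∕ Clay.  [15] = Bałaban, CMP 102 (1985) 277 [Balaban1985Variational];
[6] = CMP 99 (1985) 75 [Balaban1985RegularSpaces]; [III] = CMP 119 (1988) 243 [Balaban1988Convergent]; [I] = CMP 109 (1987) 249 [Balaban1987RG1]; [II] = CMP 122 (1989) 355 [Balaban1989LargeFieldII].
-/

noncomputable section

open scoped Matrix.Norms.L2Operator

namespace Summit.QuantumFields.YangMills.Theorems.K0PrintCubeOfStepTokensR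

open Literature.MathematicalPhysics.QuantumFieldTheory.Balaban1983to89
open Literature.MathematicalPhysics.QuantumFieldTheory.Balaban1983to89.Node00
open Literature.MathematicalPhysics.QuantumFieldTheory.Balaban1983to89.T4Continuum
open Literature.MathematicalPhysics.QuantumFieldTheory.Balaban1983to89.FlowStep
open Literature.MathematicalPhysics.QuantumFieldTheory.Balaban1983to89.B8LeafModelZd (ZdIdx)
open Summit.QuantumFields.YangMills.Theorems.K0GenericCubeOfStepTokensR (record13SepCoPHBody_of_stub1_of_gauge9Supplier_of_absBetaBoxAt)

/-! ## §1  The witness index `j := ρ₀ + 3` clears the print floor, and stub 2′ fills PART 1's (9)-supplier slot -/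

section Supplier

variable (F : T4Family)

/-- **THE PRINT FLOOR FITS UNDER THE CUBE LETTER `L^(ρ₀+3)`**: `(11·4 + 4·(ρ₀·L))·L ≤ L^(ρ₀+3)` for `1 ≤ ρ₀` (`L ≥ 13`: `ρ₀ < L^ρ₀`, so `44 + 4ρ₀L ≤ 13·L·ρ₀ ≤ L²·L^ρ₀`). A2ʷ's collar
reading `c ≤ M₁ = L^j` at the index the composition picks. [cite: Balaban1985RegularSpaces, (1.130) p.99, p.98 (bookkeeping); Balaban1985Variational, (144) p.300] -/
theorem floorP_mul_le_pow {ρ₀ : ℕ} (hρ₀ : 1 ≤ ρ₀) : (11 * 4 + 4 * (ρ₀ * F.L)) * F.L ≤ F.L ^ (ρ₀ + 3) := by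
  have hL : 13 ≤ F.L := by obtain ⟨hodd, _⟩ := F.hL; have := F.hL11; rcases hodd with ⟨r, hr⟩; omega
  have hρ : ρ₀ ≤ F.L ^ ρ₀ := (Nat.lt_pow_self (by omega)).le
  have h1 : 44 + 4 * (ρ₀ * F.L) ≤ F.L * F.L * F.L ^ ρ₀ := by
    have h2 : 44 + 4 * (ρ₀ * F.L) ≤ 13 * F.L * ρ₀ := by nlinarith
    have h3 : 13 * F.L * ρ₀ ≤ F.L * F.L * ρ₀ := Nat.mul_le_mul_right _ (Nat.mul_le_mul_right _ hL)
    exact h2.trans (h3.trans (Nat.mul_le_mul_left _ hρ))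
  calc (11 * 4 + 4 * (ρ₀ * F.L)) * F.L = (44 + 4 * (ρ₀ * F.L)) * F.L := by ring
    _ ≤ (F.L * F.L * F.L ^ ρ₀) * F.L := Nat.mul_le_mul_right _ h1
    _ = F.L ^ (ρ₀ + 3) := by ring

/-- **STUB 2′ AT `F` FILLS PART 1's (9)-SUPPLIER SLOT AT `F`**: from [6] Prop. 6 on print's cube class at big-block size `ρ₀ ≥ 1` (`zdCubP (MatA 2) L ρ₀`, constants `0 ≤ B₁`, `0 < c₁`), for every
guarded `(B₃, a₀, a₁)` carrying [15] Prop. 8's top step, the floor-carrying (9)-token holds at the cube letter `(L^(ρ₀+3), (11·4 + 4·(ρ₀·L))·L)` with `B₉ = b9OfP·B₃` and the shrunk ceiling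
`a₁′ = min a₁ (a0OfP∕B₃)` — dag-n07-e's (b2) `gauge9RP_of_prop8TopStep_of_prop6P_of_one_le` BY NAME at `M := L^(ρ₀+3)`, Prop. 8's ceiling shrunk by `.of_le`.  CONDITIONAL.
[cite: Balaban1985Variational, Thm 1 (8)–(10) p.279, (144)–(152) pp.300–301, Prop. 8 p.304; Balaban1985RegularSpaces, Prop. 6 p.99, p.98] -/
theorem gauge9Supplier_of_prop6MemberP
    (h2P : ∃ (ρ₀ : ℕ) (B₁ c₁ : ℝ), 1 ≤ ρ₀ ∧ 0 ≤ B₁ ∧ 0 < c₁ ∧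
      (letI : CStarAlgebra (MatA 2) := {}; B8.Prop6Printed 4 (F.L : ℝ) B₁ c₁ (fun i : ZdIdx 4 F.L => zdCubP (MatA 2) F.L ρ₀ i)))
    (B₃ a₀ a₁ : ℝ) (hB₃ : 2 * (F.L : ℝ) ^ 2 ≤ B₃) (_ha₀ : 0 < a₀) (ha₁ : 0 < a₁)
    (h8 : Prop8RegSepTopStep F 2 (fun ν K Ω => suppDomOfRecord F ν K Ω) B₃ a₀ a₁) :
    ∃ (j c : ℕ) (B₉ a₁' : ℝ), c ≤ F.L ^ j ∧ 0 < B₉ ∧ 0 < a₁' ∧ a₁' ≤ a₁ ∧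
      Gauge9RegSepTopStepR F 2 (fun ν K Ω => suppDomOfRecord F ν K Ω) (F.L ^ j) c B₃ B₉ a₀ a₁' := by
  obtain ⟨ρ₀, B₁, c₁, hρ₀, hB₁, hc₁, hP6⟩ := h2P
  have hL : (0 : ℝ) < (F.L : ℝ) := by exact_mod_cast lt_trans Nat.zero_lt_one F.hL.2
  have hBpos : (0 : ℝ) < B₃ := lt_of_lt_of_le (mul_pos two_pos (pow_pos hL 2)) hB₃
  set M : ℕ := F.L ^ (ρ₀ + 3) with hM
  have ha0P : 0 < a0OfP F 2 M (ρ₀ * F.L) B₁ c₁ := a0OfP_pos (F := F) (N := 2) M (ρ₀ * F.L) hB₁ hc₁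
  have ha₁' : 0 < min a₁ (a0OfP F 2 M (ρ₀ * F.L) B₁ c₁ / B₃) := lt_min ha₁ (div_pos ha0P hBpos)
  have hle : B₃ * min a₁ (a0OfP F 2 M (ρ₀ * F.L) B₁ c₁ / B₃) ≤ a0OfP F 2 M (ρ₀ * F.L) B₁ c₁ :=
    calc B₃ * min a₁ (a0OfP F 2 M (ρ₀ * F.L) B₁ c₁ / B₃) ≤ B₃ * (a0OfP F 2 M (ρ₀ * F.L) B₁ c₁ / B₃) :=
          mul_le_mul_of_nonneg_left (min_le_right _ _) hBpos.le
      _ = a0OfP F 2 M (ρ₀ * F.L) B₁ c₁ := mul_div_cancel₀ _ hBpos.ne'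
  exact ⟨ρ₀ + 3, (11 * 4 + 4 * (ρ₀ * F.L)) * F.L, b9OfP F M (ρ₀ * F.L) B₁ * B₃, min a₁ (a0OfP F 2 M (ρ₀ * F.L) B₁ c₁ / B₃), floorP_mul_le_pow F hρ₀,
    mul_pos (b9OfP_pos (F := F) M (ρ₀ * F.L) hB₁) hBpos, ha₁', min_le_left _ _,
    gauge9RP_of_prop8TopStep_of_prop6P_of_one_le (h8.of_le le_rfl (min_le_left _ _)) hB₁ hc₁ hρ₀ hP6 M hBpos hle⟩

end Supplier

/-! ## §2  ★★★ The print-cube composition: stub 1 ∧ stub 2′ ∧ 3ᴬ′ ⟹ K0⁷'s body on every family -/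

section Composition

/-- **★★★ K0⁷'s BODY AT EVERY FAMILY FROM STUB 1, STUB 2′ AND 3ᴬ′** — `h1` = V18 stub 1 VERBATIM ([15] Prop. 8's top step at the record's support selector for SOME guarded `(B₃, a₀, a₁)`);
`h2P` = STUB 2′ VERBATIM (plan g79 l.24860: [6] Prop. 6 on PRINT's cube class at SOME big-block size `ρ₀ ≥ 1`, `Node00.zdCubP (MatA 2) L ρ₀`, constants `0 ≤ B₁`, `0 < c₁`); `h3A'` = 3ᴬ′
(PART 1's text: the sign-free β-box of A1's witness `θ₁₅ᶜᶜᴹ(j)` on some window, for every cube letter `(j, c)` with `c ≤ L^j` and every guarded tuple carrying (8) and the (9)-token there — ρ₀-free).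
Proof: §1 fills PART 1's supplier slot at the cube letter `(L^(ρ₀+3), (44 + 4ρ₀L)·L)`, then `record13SepCoPHBody_of_stub1_of_gauge9Supplier_of_absBetaBoxAt`.  CONDITIONAL; K0⁷ NOT closed here;
nothing of Bałaban asserted; V18 stands — this is the (b3) input of the plan's V19. [cite: Balaban1985Variational, Thm 1 (8)–(9) p.279, (144)–(152) pp.300–301, Prop. 8 p.304; Balaban1985RegularSpaces, Prop. 6 p.99, p.98; Balaban1988Convergent, Thm 1 p.262, (2.6)–(2.8) pp.255–256, p.257; Balaban1987RG1, Thm 1 p.259, §1 p.264] -/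
theorem record13SepCoPHBody_of_stubs1_2P_3A'
    (h1 : ∀ F : T4Family, ∃ B₃ a₀ a₁ : ℝ, 2 * (F.L : ℝ) ^ 2 ≤ B₃ ∧ 0 < a₀ ∧ 0 < a₁ ∧
      Prop8RegSepTopStep F 2 (fun ν K Ω => suppDomOfRecord F ν K Ω) B₃ a₀ a₁)
    (h2P : ∀ F : T4Family, ∃ (ρ₀ : ℕ) (B₁ c₁ : ℝ), 1 ≤ ρ₀ ∧ 0 ≤ B₁ ∧ 0 < c₁ ∧
      (letI : CStarAlgebra (MatA 2) := {}; B8.Prop6Printed 4 (F.L : ℝ) B₁ c₁ (fun i : ZdIdx 4 F.L => zdCubP (MatA 2) F.L ρ₀ i)))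
    (h3A' : ∀ (F : T4Family) (j c : ℕ) (B₃ B₃' a₀ a₁ : ℝ), c ≤ F.L ^ j → 2 * (F.L : ℝ) ^ 2 ≤ B₃ → 0 < B₃' → 0 < a₀ → 0 < a₁ →
      VariationalThm1RegSepCoP7M F 2 B₃ a₀ a₁ →
      Gauge9RegSepTopStepR F 2 (fun ν K Ω => suppDomOfRecord F ν K Ω) (F.L ^ j) c B₃ B₃' a₀ a₁ →
      ∃ γ₀ ε₀ ε₂₉ β' : ℝ, 0 < γ₀ ∧ 0 < ε₀ ∧ 0 < ε₂₉ ∧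
        BetaLowerH (-β') γ₀ (betaOfRecord₁₃ F 2 (theta13OfThm1CCM F 2 j ε₀ ε₂₉ B₃ B₃' a₀ a₁)) ∧
        BetaUpperH β' γ₀ (betaOfRecord₁₃ F 2 (theta13OfThm1CCM F 2 j ε₀ ε₂₉ B₃ B₃' a₀ a₁))) :
    ∀ F : T4Family, ∃ θ : Stage13HParams F 2, θ.Provisos₁₃SepCoPH F 2 ∧ (θ.ZhUnity F 2 ∧ θ.SlotsNondegenerate₁₃ F 2) ∧ θ.Admissible F 2 :=
  record13SepCoPHBody_of_stub1_of_gauge9Supplier_of_absBetaBoxAt h1 (fun F => gauge9Supplier_of_prop6MemberP F (h2P F)) h3A'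

end Composition

/-! ## §3  The direction of the repair: V18's stub 2 ⟹ stub 2′ (sanity) -/

section Direction

/-- **V18's STUB 2 ⟹ STUB 2′** (at `ρ₀ = 1`, (b1)'s `prop6Printed_zdCubP_of_zdCub`: Prop. 6 on ALL cubes restricts to print's class) — stub 2′ is WEAKER than stub 2; never conversely for
`ρ₀ > 1`.  So every road to V18's stub 2 still lands after the re-cut. [cite: Balaban1985RegularSpaces, Prop. 6 p.99, p.98 (bookkeeping)] -/
theorem prop6MemberP_of_prop6Member (F : T4Family)
    (h2 : ∃ B₁ c₁ : ℝ, 0 ≤ B₁ ∧ 0 < c₁ ∧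
      (letI : CStarAlgebra (MatA 2) := {}; B8.Prop6Printed 4 (F.L : ℝ) B₁ c₁ (fun i : ZdIdx 4 F.L => zdCub (MatA 2) F.L i))) :
    ∃ (ρ₀ : ℕ) (B₁ c₁ : ℝ), 1 ≤ ρ₀ ∧ 0 ≤ B₁ ∧ 0 < c₁ ∧
      (letI : CStarAlgebra (MatA 2) := {}; B8.Prop6Printed 4 (F.L : ℝ) B₁ c₁ (fun i : ZdIdx 4 F.L => zdCubP (MatA 2) F.L ρ₀ i)) := by
  obtain ⟨B₁, c₁, hB₁, hc₁, hP6⟩ := h2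
  letI : CStarAlgebra (MatA 2) := {}
  exact ⟨1, B₁, c₁, le_rfl, hB₁, hc₁, prop6Printed_zdCubP_of_zdCub (𝔸 := MatA 2) id 1 hP6⟩

end Direction

end Summit.QuantumFields.YangMills.Theorems.K0PrintCubeOfStepTokensR

end
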